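/-
Copyright (c) 2026 the pub-hodgecm-mathlib formalisation cell (harness21).  Prover seat hodgecm-mathlib-R90-IF-p03 (g4), S9 «InnerForm-13.3.6 (c)»,
filing S2 CARD 10 (S2 dealer K2E1b-plan (g8) booking 2026-09-05T02:44:36Z; S9 dealer R90-IF-plan (g2) ruling 02:45:41Z «GO CARD 10 FIRST»):
the two archimedean carriers of record lie in the support class of ★ `globalCharactersLinIndep` — admissible `ρK`, infinitesimally unitary
along `𝔭 ⊕ ℝz₀` — BY NAME from ★ `K2E1bCarriersOfRecord.jRepOfRecord_package` ∕ `dsRepOfRecord_package`.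
-/
import Summits.HodgeConjecture.HodgeConjecture.Theorems.K2E1bCarriersOfRecord   -- ★ #23 (K2E1b): `jRepOfRecord`, `dsRepOfRecord`, `jInfOfRecord`, `dsInfOfRecord`, `…_package`
import Literature.NumberTheory.Automorphic.GKInfinitesimallyUnitary          -- ★ `GKIrrep.IsInfUnitaryAlongP` (token for token the floor's `IsUnitaryAlongP`)
import HarnessLib

/-!
# R90 ∕ S2 «archimedean packets», CARD 10 (XS): THE CARRIERS OF RECORD ARE ADMISSIBLE AND INFINITESIMALLY UNITARY ALONG `P` —
# `jInfOfRecord_mem_support` ∕ `dsInfOfRecord_mem_support`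

Cell `pub/hodgecm-mathlib` (D-0151), crux H413 = `stmt-HodgeConjecture-24833` (`--supports … --as helper`; closes nothing by itself).
JUNCTION JQ-S7-13 (arch third): the S9 producer letters `ha₀ ∕ ha₂` of the A2 chain (★ `R90S9HcoeffMemChainA2` §4 ∕ ★ M3 binders) ask that the
classes `a₀ := jInfOfRecord p q t` (`πⁿ(ξ_∞)`, the non-tempered Langlands quotient `J`) and `a₂ := dsInfOfRecord p q t` (`πˢ(ξ_∞)`, the
square-integrable member) of the archimedean A-packet of record `Π(ξ_∞) = {πⁿ(ξ_∞), πˢ(ξ_∞)}` [Rogawski1990, §12.3 p. 178] lie in the support class of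
★ `globalCharactersLinIndep`, spelled VERBATIM as its support conjunct
`∃ r : GKIrrep (uFormGroup (Fin 2) (Fin 1)), GKIrrClass.mk r = x.1 ∧ IsAdmissibleGK r.ρK ∧ r.IsInfUnitaryAlongP`.
Both are paid BY NAME: the witnesses are the bundled carriers ★ `jRepOfRecord p q t` ∕ ★ `dsRepOfRecord p q t` (`GKIrrClass.mk _ = _` by `rfl`,
★ `K2E1bCarriersOfRecord` :326 ∕ :330), admissibility is the field `.adm : IsAdmissibleGK ρK` and unitarity the field `.unit : IsUnitaryAlongP ρ𝔤` of the
★ cohomological-unitary packages `jRepOfRecord_package` ∕ `dsRepOfRecord_package` (★ :335 ∕ :344; [BorelWallach2000, VI Thm. 4.12 (2), 0 §2.5];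
[Kovacevic2021, §4]), and ★ `GKIrrep.IsInfUnitaryAlongP r := IsInfUnitaryAlongP r.ρ𝔤` repeats the floor's `IsUnitaryAlongP` TOKEN FOR TOKEN
(`Literature/NumberTheory/Automorphic/GKInfinitesimallyUnitary.lean` :68–:84, `isInfUnitaryAlongP_iff := Iff.rfl`), so `.unit` is accepted at type
`r.IsInfUnitaryAlongP` by `δ`-unfolding — no bridge lemma is needed and none is filed.
The two theorems are S2's GREEN probe `K2/K2E1b-plan/g8/PROBE-CARD10-CarriersSupport.v1.K2E1b-plan-g8.lean` (sha16 c81f405691afcec6) byte for byte,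
lifted into namespace `Summit.HodgeConjecture.HodgeConjecture.R90.S2`; consumed BY NAME by S9 file B at ED. 5 when `a₀ a₂` get closed terms.
THEOREMS ONLY (no definition ∕ instance ∕ notation ∕ named fact ∕ `sorry`); imports ★ Theorems + ★ Literature only (never a `Cruxes/…/Lines` module).
HONEST LABEL: by-name repackaging of ★ K2E1b facts, pays no NEW printed input; HC_CM is proved only modulo the 7 printed citations (2 remaining named
inputs: hLiu418 = stmt-HodgeConjecture-24832, h413 = stmt-HodgeConjecture-24833) until rung 0 closes; count-neutral.

## References
* [Rogawski1990] J. Rogawski, *Automorphic Representations of Unitary Groups in Three Variables*, Annals of Math. Studies 123 (1990), §12.3 p. 178.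
* [BorelWallach2000] A. Borel, N. Wallach, *Continuous Cohomology, Discrete Subgroups, and Representations of Reductive Groups*, 2nd ed. (2000),
  0 §2.5 (p. 4), VI Thm. 4.12 (2).
* [Kovacevic2021] D. Kovačević, *Classification of irreducible unitary `(𝔤,K)`-modules of `SU(2,1)` via `K`-types* (2021), §4.
-/

set_option autoImplicit false
set_option linter.dupNamespace false

noncomputable section

open Literature.RepresentationTheory Literature.NumberTheory.Automorphic
open Literature.RepresentationTheory.KonnoKonno2007

namespace Summit.HodgeConjecture.HodgeConjecture.R90.S2

open Summit.HodgeConjecture.HodgeConjecture.Cruxes.H413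
open Summit.HodgeConjecture.HodgeConjecture.Cruxes.H413.K2E1bCarriersOfRecord (jRepOfRecord dsRepOfRecord jInfOfRecord dsInfOfRecord
  jRepOfRecord_package dsRepOfRecord_package)

/-- the `J`-carrier class of record lies in the support class of ★ `globalCharactersLinIndep` (admissible `ρK`, inf-unitary along `P`). -/
theorem jInfOfRecord_mem_support (p q t : ℤ) :
    ∃ r : GKIrrep (uFormGroup (Fin 2) (Fin 1)), GKIrrClass.mk r = jInfOfRecord p q t ∧ IsAdmissibleGK r.ρK ∧ r.IsInfUnitaryAlongP :=
  ⟨jRepOfRecord p q t, rfl, (jRepOfRecord_package p q t).1.adm, (jRepOfRecord_package p q t).1.unit⟩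

/-- the square-integrable carrier class of record lies in the support class of ★ `globalCharactersLinIndep`. -/
theorem dsInfOfRecord_mem_support (p q t : ℤ) :
    ∃ r : GKIrrep (uFormGroup (Fin 2) (Fin 1)), GKIrrClass.mk r = dsInfOfRecord p q t ∧ IsAdmissibleGK r.ρK ∧ r.IsInfUnitaryAlongP :=
  ⟨dsRepOfRecord p q t, rfl, (dsRepOfRecord_package p q t).1.adm, (dsRepOfRecord_package p q t).1.unit⟩

end Summit.HodgeConjecture.HodgeConjecture.R90.S2

end
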